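import Literature.AlgebraicGeometry.Motives.GaloisThickening
import Literature.AlgebraicGeometry.Motives.RestrictScalarsPoints
import Literature.AlgebraicGeometry.Motives.BaseChangePointsProofs
import Literature.AlgebraicGeometry.Motives.AlgPointsProperProofs
import Literature.AlgebraicGeometry.Motives.AlgPointsSeparate
import Literature.NumberTheory.Transcendental.AnalytificationSeparatedProofs
import HarnessLib

/-!
# Complex points of a base change `X ⊗_k K` along an embedding `τ′ : K → ℂ` extending `τ : k → ℂ`: the homeomorphism with the
# complex points of `X` along `τ`, its Galois equivariance, and the comparison of the two complex fibres

Topic `AlgebraicGeometry/Motives`; namespace `Literature.AlgebraicGeometry.Motives`.  THEOREMS ONLY (no definition, no instance, no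
notation, no named fact, no `sorry`): every map is packaged existentially with the equations that pin it on underlying morphisms.
Generic in fields `k ⊆ K ⊂ ℂ` (`τ′ ∘ (k → K) = τ`) and a `k`-scheme `X` (proper for the homeomorphism).  Cell `hodgecm-mathlib`
(D-0151), programme P6 «MOD» (crux hLiu418 = stmt-HodgeConjecture-24832, `--supports`): the plumbing that feeds ★
`UnitaryShimuraCurveWeakCanonicalUnique` (weak uniqueness over `E′ ⊇ L`, [Deligne1979ShimuraVarieties] 2.2.6) with `Y := (S.M K) ⊗_L E′`
(sequel `UnitaryShimuraCurveRecordBaseChangeWeak`).  HONEST LABEL: HC_CM is proved only modulo the 2 remaining named inputs (hLiu418 24832,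
h413 24833) until rung 0 closes; this file is count-neutral capital.

THE MATHEMATICS ([GortzWedhorn2020] §(4.7)–(4.9), Prop. 4.16; [Hartshorne1977] II.3, Ex. II.4.7).  Let `Y := X ⊗_k K` (★ `baseChange k K`).
A `ℂ`-point of `Y` along `τ′` is a morphism `P : Spec ℂ → X ×_k Spec K` over `Spec K`; its first projection is a `ℂ`-point of `X` along
`τ = τ′|_k`, and conversely a `ℂ`-point `Q` of `X` lifts uniquely to `(Q, Spec τ′)` (the tree՚s ★ `thickeningLift` read through ★
`RestrictScalarsPoints.ofPiece`).  This bijection is continuous (★ `AlgPoints.continuous_map` ∘ ★ `continuous_ofAlong`), hence a homeomorphism when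
`X` is proper (compact source ★ `compactSpace_algPoints_of_isProper_holds`, Hausdorff target ★ `ComplexPoints.t2Space_of_isSeparated`); it
intertwines `σ ∈ Aut(ℂ∕τ′K)` with `σ|` viewed in `Aut(ℂ∕τk)` (both act by `Spec σ ≫ ·`, ★ `AlgPoints.smul_left`).  Finally the complex
fibres `(X ⊗_k K) ⊗_{K,τ′} ℂ` and `X ⊗_{k,τ} ℂ` are canonically isomorphic over `ℂ` (transitivity of base change), compatibly with the points.

* §1 **`exists_homeomorph_complexPoints_baseChange`** — `e : (X ⊗_k K)_{τ′}(ℂ) ≃ₜ X_τ(ℂ)` with `(e P).left = P.left ≫ pr₁`,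
  `(e⁻¹ Q).left ≫ pr₁ = Q.left`, `(e⁻¹ Q).left ≫ pr₂ = Spec τ′`.
* §2 **`smul_eq_of_left_comp_fst`** — such an `e` is Galois-equivariant: `e (σ • P) = (σ.restrictScalars k) • e P`.
* §3 **`exists_iso_baseChangeHom_baseChange`** — `g : ((X ⊗_k K) ⊗_{τ′} ℂ) ≅ (X ⊗_τ ℂ)` over `ℂ` with `g.left ≫ pr₁ = pr₁ ≫ pr₁`,
  `g.left ≫ pr₂ = pr₂`, and the point formula `g (bce τ′ Y P) = bce τ X (e P)` for every `e` as in §1.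

## References
* [GortzWedhorn2020] U. Görtz, T. Wedhorn, *Algebraic Geometry I* (2nd ed. 2020), §(4.7)–(4.9), Prop. 4.16.
* [Hartshorne1977] R. Hartshorne, *Algebraic Geometry* (1977), II.3 (base extension), Ex. II.4.7.
* [ConradAdelicPoints2012] B. Conrad, *Weil and Grothendieck approaches to adelic points* (2012), Prop. 2.1, Prop. 3.1.
-/

set_option autoImplicit false

noncomputable section

open CategoryTheory CategoryTheory.Limits _root_.AlgebraicGeometry _root_.Topology

namespace Literature.AlgebraicGeometry.Motives

open Literature.AlgebraicGeometry.Motives.AbelianVariety (bcSpec)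

variable {k K : Type} [Field k] [Field K] [Algebra k K] {τ : k →+* ℂ} {τ' : K →+* ℂ}

/-- `τ′` as a `k`-algebra homomorphism `K →ₐ[k] ℂ` (for the `k`-algebra structure `τ` on `ℂ`), when `τ′ ∘ (k → K) = τ`. [folklore] -/
private theorem commutes_of_comp_eq (hτ : τ'.comp (algebraMap k K) = τ) (x : k) :
    letI : Algebra k ℂ := τ.toAlgebra
    τ' (algebraMap k K x) = algebraMap k ℂ x :=
  RingHom.congr_fun hτ x

/-! ### §1. The homeomorphism `(X ⊗_k K)_{τ′}(ℂ) ≃ₜ X_τ(ℂ)` -/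

/-- **Complex points of a base change along an extended embedding** ([GortzWedhorn2020] §(4.7)–(4.9); [Hartshorne1977] II.3): for
`τ′ : K → ℂ` extending `τ : k → ℂ` and a PROPER `k`-scheme `X`, the complex points of `Y := X ⊗_k K` along `τ′` are homeomorphic to the
complex points of `X` along `τ` by `P ↦ pr₁ ∘ P`; the inverse sends `Q` to the unique point `(Q, Spec τ′)` of `X ×_k Spec K`.  The three
equations pin `e` and `e⁻¹` on underlying morphisms. [cite: GortzWedhorn2020, §(4.7)–(4.9) and Prop. 4.16]
[cite: ConradAdelicPoints2012, Prop. 2.1 and Prop. 3.1] -/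
theorem exists_homeomorph_complexPoints_baseChange (hτ : τ'.comp (algebraMap k K) = τ) (X : SchemeOver k) [IsProper X.hom] :
    ∃ e : (letI : Algebra K ℂ := τ'.toAlgebra; ComplexPoints ((baseChange k K).obj X)) ≃ₜ
        (letI : Algebra k ℂ := τ.toAlgebra; ComplexPoints X),
      (∀ P, (e P).left = P.left ≫ pullback.fst X.hom (bcSpec k K)) ∧
      (∀ Q, (e.symm Q).left ≫ pullback.fst X.hom (bcSpec k K) = Q.left) ∧
      (∀ Q, (e.symm Q).left ≫ pullback.snd X.hom (bcSpec k K) = Spec.map (CommRingCat.ofHom τ')) := by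
  letI iK : Algebra K ℂ := τ'.toAlgebra
  letI ik : Algebra k ℂ := τ.toAlgebra
  -- `τ′` as a `k`-algebra map
  let τₐ : K →ₐ[k] ℂ := { τ' with commutes' := commutes_of_comp_eq hτ }
  have hτₐ : (τₐ : K →+* ℂ) = τ' := rfl
  -- forward and backward maps on points
  let Y : SchemeOver K := (baseChange k K).obj X
  let f : ComplexPoints Y → ComplexPoints X := fun P =>
    AlgPoints.map (thickeningπ X) (AlgPoints.ofAlong Y τₐ P)
  let g : ComplexPoints X → ComplexPoints Y := fun Q =>
    AlgPoints.ofPiece Y τₐ ⟨thickeningLift τₐ X Q, embOfPoint_thickeningLift τₐ X Q⟩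
  have hf : ∀ P, (f P).left = P.left ≫ pullback.fst X.hom (bcSpec k K) := fun P => rfl
  have hg : ∀ Q, (g Q).left = (thickeningLift τₐ X Q).left := fun Q => rfl
  have hfg : ∀ Q, f (g Q) = Q := fun Q => by
    apply Over.OverMorphism.ext
    rw [hf, hg]
    exact thickeningLift_left_comp_fst τₐ X Q
  have hgf : ∀ P, g (f P) = P := fun P => by
    apply Over.OverMorphism.ext
    rw [hg, thickeningLift_left]
    apply pullback.hom_ext
    · erw [pullback.lift_fst, hf]
      rfl
    · erw [pullback.lift_snd, hτₐ]
      exact (Over.w P).symm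
  let eqv : ComplexPoints Y ≃ ComplexPoints X := ⟨f, g, hgf, hfg⟩
  -- continuity of the forward map; compact source, Hausdorff target
  have hcont : Continuous eqv := (AlgPoints.continuous_map (thickeningπ X)).comp (AlgPoints.continuous_ofAlong Y τₐ)
  haveI : IsProper Y.hom := MorphismProperty.baseChange_obj _ _ ‹_›
  haveI : CompactSpace (ComplexPoints Y) := compactSpace_algPoints_of_isProper_holds Y ℂ
  haveI : T2Space (ComplexPoints X) := ComplexPoints.t2Space_of_isSeparated X
  refine ⟨hcont.homeoOfEquivCompactToT2, fun P => hf P, fun Q => ?_, fun Q => ?_⟩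
  · change (g Q).left ≫ _ = _
    rw [hg]
    exact thickeningLift_left_comp_fst τₐ X Q
  · change (g Q).left ≫ _ = _
    rw [hg]
    exact (thickeningLift_left_comp_snd τₐ X Q).trans (by rw [hτₐ])

/-! ### §2. Galois equivariance -/

/-- **A bijection pinned by `(e P).left = P.left ≫ pr₁` is Galois-equivariant**: for `σ ∈ Aut(ℂ∕τ′K)` (an automorphism of the
`K`-algebra `ℂ`), `e (σ • P) = σ|_{k} • e P`, where `σ|_k = σ.restrictScalars k ∈ Aut(ℂ∕τk)` for the scalar tower `k → K → ℂ` given by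
`τ′ ∘ (k → K) = τ` — both sides are `Spec σ ≫ P ≫ pr₁` (★ `AlgPoints.smul_left`; [Hartshorne1977] Ex. II.4.7). [cite: Hartshorne1977, Ex. II.4.7]
[cite: GortzWedhorn2020, (14.20)] -/
theorem smul_eq_of_left_comp_fst (hτ : τ'.comp (algebraMap k K) = τ) (X : SchemeOver k)
    (e : (letI : Algebra K ℂ := τ'.toAlgebra; ComplexPoints ((baseChange k K).obj X)) →
        (letI : Algebra k ℂ := τ.toAlgebra; ComplexPoints X))
    (he : ∀ P, (e P).left = P.left ≫ pullback.fst X.hom (bcSpec k K))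
    (σ : letI : Algebra K ℂ := τ'.toAlgebra; ℂ ≃ₐ[K] ℂ)
    (P : letI : Algebra K ℂ := τ'.toAlgebra; ComplexPoints ((baseChange k K).obj X)) :
    letI : Algebra K ℂ := τ'.toAlgebra
    letI : Algebra k ℂ := τ.toAlgebra
    haveI : IsScalarTower k K ℂ := IsScalarTower.of_algebraMap_eq fun x => (commutes_of_comp_eq hτ x).symm
    e (σ • P) = (σ.restrictScalars k) • e P := by
  letI : Algebra K ℂ := τ'.toAlgebra
  letI : Algebra k ℂ := τ.toAlgebra
  haveI : IsScalarTower k K ℂ := IsScalarTower.of_algebraMap_eq fun x => (commutes_of_comp_eq hτ x).symm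
  apply Over.OverMorphism.ext
  rw [he, AlgPoints.smul_left, AlgPoints.smul_left, he]
  exact Category.assoc _ _ _

/-! ### §3. The two complex fibres: `(X ⊗_k K) ⊗_{K,τ′} ℂ ≅ X ⊗_{k,τ} ℂ` over `ℂ`, compatibly with the points -/

/-- **Transitivity of base change, read on the complex fibres** ([GortzWedhorn2020] Prop. 4.16): for `τ′ ∘ (k → K) = τ`, an isomorphism
`g : (X ⊗_k K) ⊗_{K,τ′} ℂ ≅ X ⊗_{k,τ} ℂ` OVER `Spec ℂ` (★ `baseChangeHom`) with `g.left ≫ pr₁ = pr₁ ≫ pr₁` and `g.left ≫ pr₂ = pr₂`, and the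
point formula: for every bijection `e` of §1 (pinned by `(e P).left = P.left ≫ pr₁`) and every complex point `P` of `X ⊗_k K` along `τ′`,
`g (bce_{τ′} P) = bce_τ (e P)` (★ `AlgPoints.baseChangeEquiv`). [cite: GortzWedhorn2020, Prop. 4.16 and §(4.7)] [cite: Hartshorne1977, II.3 Thm. 3.3] -/
theorem exists_iso_baseChangeHom_baseChange (hτ : τ'.comp (algebraMap k K) = τ) (X : SchemeOver k) :
    ∃ g : (baseChangeHom τ').obj ((baseChange k K).obj X) ≅ (baseChangeHom τ).obj X,
      g.hom.left ≫ pullback.fst X.hom (Spec.map (CommRingCat.ofHom τ)) =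
          pullback.fst ((baseChange k K).obj X).hom (Spec.map (CommRingCat.ofHom τ')) ≫ pullback.fst X.hom (bcSpec k K) ∧
      g.hom.left ≫ pullback.snd X.hom (Spec.map (CommRingCat.ofHom τ)) =
          pullback.snd ((baseChange k K).obj X).hom (Spec.map (CommRingCat.ofHom τ')) ∧
      ∀ (e : (letI : Algebra K ℂ := τ'.toAlgebra; ComplexPoints ((baseChange k K).obj X)) →
          (letI : Algebra k ℂ := τ.toAlgebra; ComplexPoints X)),
        (∀ P, (e P).left = P.left ≫ pullback.fst X.hom (bcSpec k K)) →
        ∀ P, letI : Algebra K ℂ := τ'.toAlgebra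
             letI : Algebra k ℂ := τ.toAlgebra
             AlgPoints.map g.hom (AlgPoints.baseChangeEquiv τ' ((baseChange k K).obj X) P) =
               AlgPoints.baseChangeEquiv τ X (e P) := by
  -- the tower of Spec maps
  have htow : Spec.map (CommRingCat.ofHom τ') ≫ bcSpec k K = Spec.map (CommRingCat.ofHom τ) := by
    change Spec.map _ ≫ Spec.map _ = _
    rw [← Spec.map_comp, ← CommRingCat.ofHom_comp, hτ]
  -- the two underlying morphisms, abstracted by their defining equations
  obtain ⟨φ, hφ1, hφ2⟩ : ∃ φ : pullback ((baseChange k K).obj X).hom (Spec.map (CommRingCat.ofHom τ')) ⟶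
      pullback X.hom (Spec.map (CommRingCat.ofHom τ)),
      φ ≫ pullback.fst X.hom _ = pullback.fst ((baseChange k K).obj X).hom _ ≫ pullback.fst X.hom (bcSpec k K) ∧
      φ ≫ pullback.snd X.hom _ = pullback.snd ((baseChange k K).obj X).hom _ := by
    refine ⟨pullback.lift (pullback.fst ((baseChange k K).obj X).hom _ ≫ pullback.fst X.hom (bcSpec k K))
      (pullback.snd ((baseChange k K).obj X).hom _) ?_, pullback.lift_fst _ _ _, pullback.lift_snd _ _ _⟩
    have h1 : pullback.fst ((baseChange k K).obj X).hom (Spec.map (CommRingCat.ofHom τ')) ≫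
        pullback.fst X.hom (bcSpec k K) ≫ X.hom =
        pullback.fst ((baseChange k K).obj X).hom (Spec.map (CommRingCat.ofHom τ')) ≫
          pullback.snd X.hom (bcSpec k K) ≫ bcSpec k K :=
      congrArg (pullback.fst ((baseChange k K).obj X).hom (Spec.map (CommRingCat.ofHom τ')) ≫ ·) pullback.condition
    have h2 : pullback.fst ((baseChange k K).obj X).hom (Spec.map (CommRingCat.ofHom τ')) ≫
        pullback.snd X.hom (bcSpec k K) =
        pullback.snd ((baseChange k K).obj X).hom (Spec.map (CommRingCat.ofHom τ')) ≫ Spec.map (CommRingCat.ofHom τ') :=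
      pullback.condition
    erw [Category.assoc, h1, ← Category.assoc, h2, Category.assoc, htow]
  obtain ⟨ψ, hψ1, hψ2, hψ3⟩ : ∃ ψ : pullback X.hom (Spec.map (CommRingCat.ofHom τ)) ⟶
      pullback ((baseChange k K).obj X).hom (Spec.map (CommRingCat.ofHom τ')),
      (ψ ≫ pullback.fst ((baseChange k K).obj X).hom _) ≫ pullback.fst X.hom (bcSpec k K) = pullback.fst X.hom _ ∧
      (ψ ≫ pullback.fst ((baseChange k K).obj X).hom _) ≫ pullback.snd X.hom (bcSpec k K) =
        pullback.snd X.hom _ ≫ Spec.map (CommRingCat.ofHom τ') ∧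
      ψ ≫ pullback.snd ((baseChange k K).obj X).hom _ = pullback.snd X.hom _ := by
    have hc : pullback.fst X.hom (Spec.map (CommRingCat.ofHom τ)) ≫ X.hom =
        (pullback.snd X.hom (Spec.map (CommRingCat.ofHom τ)) ≫ Spec.map (CommRingCat.ofHom τ')) ≫ bcSpec k K := by
      erw [pullback.condition, Category.assoc, htow]
    let ψ₀ : pullback X.hom (Spec.map (CommRingCat.ofHom τ)) ⟶ pullback X.hom (bcSpec k K) :=
      pullback.lift (pullback.fst X.hom _) (pullback.snd X.hom _ ≫ Spec.map (CommRingCat.ofHom τ')) hc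
    have hψ₀1 : ψ₀ ≫ pullback.fst X.hom (bcSpec k K) = pullback.fst X.hom _ := pullback.lift_fst _ _ _
    have hψ₀2 : ψ₀ ≫ pullback.snd X.hom (bcSpec k K) = pullback.snd X.hom _ ≫ Spec.map (CommRingCat.ofHom τ') :=
      pullback.lift_snd _ _ _
    have hc' : ψ₀ ≫ ((baseChange k K).obj X).hom =
        pullback.snd X.hom (Spec.map (CommRingCat.ofHom τ)) ≫ Spec.map (CommRingCat.ofHom τ') := hψ₀2
    refine ⟨pullback.lift ψ₀ (pullback.snd X.hom _) hc', ?_, ?_, pullback.lift_snd _ _ _⟩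
    · erw [pullback.lift_fst]; exact hψ₀1
    · erw [pullback.lift_fst]; exact hψ₀2
  -- `φ ≫ ψ = 𝟙`, `ψ ≫ φ = 𝟙`
  have hφψ : φ ≫ ψ = 𝟙 _ := by
    apply pullback.hom_ext
    · apply pullback.hom_ext
      · erw [Category.assoc, Category.assoc, hψ1, hφ1, Category.id_comp]
        rfl
      · erw [Category.assoc, Category.assoc, hψ2, ← Category.assoc, hφ2, Category.id_comp]
        exact pullback.condition.symm
    · erw [Category.assoc, hψ3, hφ2, Category.id_comp]
  have hψφ : ψ ≫ φ = 𝟙 _ := by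
    apply pullback.hom_ext
    · erw [Category.assoc, hφ1, ← Category.assoc, hψ1, Category.id_comp]
    · erw [Category.assoc, hφ2, hψ3, Category.id_comp]
  -- as an isomorphism over `Spec ℂ`
  have hφw : φ ≫ ((baseChangeHom τ).obj X).hom = ((baseChangeHom τ').obj ((baseChange k K).obj X)).hom := hφ2
  let g : (baseChangeHom τ').obj ((baseChange k K).obj X) ≅ (baseChangeHom τ).obj X :=
    Over.isoMk (Iso.mk φ ψ hφψ hψφ) hφw
  have hgl : g.hom.left = φ := rfl
  refine ⟨g, ?_, ?_, fun e he P => ?_⟩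
  · rw [hgl]; exact hφ1
  · rw [hgl]; exact hφ2
  · letI : Algebra K ℂ := τ'.toAlgebra
    letI : Algebra k ℂ := τ.toAlgebra
    apply Over.OverMorphism.ext
    change (AlgPoints.baseChangeEquiv τ' ((baseChange k K).obj X) P).left ≫ g.hom.left =
      (AlgPoints.baseChangeEquiv τ X (e P)).left
    rw [hgl]
    apply pullback.hom_ext
    · have h1 := AlgPoints.baseChangeEquiv_apply_left_comp_fst τ' ((baseChange k K).obj X) P
      have h2 := AlgPoints.baseChangeEquiv_apply_left_comp_fst τ X (e P)
      change (AlgPoints.baseChangeEquiv τ' ((baseChange k K).obj X) P).left ≫ pullback.fst _ _ = _ at h1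
      change (AlgPoints.baseChangeEquiv τ X (e P)).left ≫ pullback.fst _ _ = _ at h2
      erw [Category.assoc, hφ1, ← Category.assoc, h1, h2, he]
      rfl
    · have h1 := AlgPoints.baseChangeEquiv_apply_left_comp_snd τ' ((baseChange k K).obj X) P
      have h2 := AlgPoints.baseChangeEquiv_apply_left_comp_snd τ X (e P)
      erw [Category.assoc, hφ2, h1, h2]

end Literature.AlgebraicGeometry.Motives

end
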